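import Mathlib
import Literature.NumberTheory.Sieve.Maynard2016OmegaSmall
import Literature.NumberTheory.Sieve.GoldstonPintzYildirimCounting
import HarnessLib

/-!
# Maynard 2016: the admissible residue classes modulo `P_w`

Topic `Literature/NumberTheory/Sieve`. J. Maynard, *Large gaps between primes*, Ann. of Math. (2)
183 (2016), 915–933 = arXiv:1408.5110, §4 display (4.1) (the range `n ≤ U/m`,
`(n(mn − 1), P_w) = 1`) and §6, proofs of Lemmas 6 and 7 ("we first split the sum into residue
classes modulo `P_w`"; display (6.6)). By the Chinese remainder theorem the number of classes
`n (mod P_w)` with `(n(mn − 1), P_w) = 1` is `∏_{p ≤ w} (p − ω_m(p))`, `ω_m(p) = 1` if `p ∣ m` and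
`= 2` if `p ∤ m` (`m ≥ 1`); e.g. it is `0` for odd `m` (the factor at `p = 2`).

PROVED here (no named facts), with the CRT engine `GPY.sum_range_prod_eq_prod_sum` of the tree:
`not_coprime_prime_iff` (local condition), `coprime_mul_sub_one_iff_forall`,
`card_filter_range_dvd_or_mul_modEq_one` (local count `ω_m(p)` on `[0, p)`),
`card_filter_range_primorial_coprime` (general primorial) and `card_filter_range_Pw_coprime`.

## References

* J. Maynard, *Large gaps between primes*, Ann. of Math. (2) 183 (2016), 915–933; arXiv:1408.5110,
  §4 (4.1), §6 (6.6). [Maynard2016LargeGaps]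
-/

open Filter Finset
open scoped Topology

namespace Literature.NumberTheory.Sieve

namespace Maynard2016

/-- For a prime `p`, `m ≥ 1`: `p ∣ n(mn − 1)` iff `p ∣ n` or `mn ≡ 1 (mod p)`. [cite: Maynard2016LargeGaps, §6 display (6.6)] -/
theorem prime_dvd_mul_sub_one_iff {p m n : ℕ} (hp : p.Prime) (hm : 1 ≤ m) :
    p ∣ n * (m * n - 1) ↔ (p ∣ n ∨ m * n ≡ 1 [MOD p]) := by
  rcases Nat.eq_zero_or_pos n with rfl | hn
  · simp
  · have h1 : 1 ≤ m * n := by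
      have := Nat.mul_le_mul hm hn
      simpa using this
    rw [hp.dvd_mul, ← Nat.modEq_iff_dvd' h1]
    exact or_congr Iff.rfl ⟨fun h => h.symm, fun h => h.symm⟩

/-- `(n(mn − 1), ∏_{p ∈ S} p) = 1` iff for every prime `p ∈ S`: `p ∤ n` and `mn ≢ 1 (mod p)`
(`m ≥ 1`). [cite: Maynard2016LargeGaps, §4 display (4.1)] -/
theorem coprime_mul_sub_one_iff_forall {m n : ℕ} (hm : 1 ≤ m) (S : Finset ℕ)
    (hS : ∀ p ∈ S, p.Prime) :
    Nat.Coprime (n * (m * n - 1)) (∏ p ∈ S, p) ↔ ∀ p ∈ S, ¬ (p ∣ n ∨ m * n ≡ 1 [MOD p]) := by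
  rw [Nat.coprime_prod_right_iff]
  refine forall₂_congr fun p hp => ?_
  rw [Nat.coprime_comm, (hS p hp).coprime_iff_not_dvd, prime_dvd_mul_sub_one_iff (hS p hp) hm]

/-- The local count on `[0, p)`: `#{0 ≤ a < p : p ∣ a ∨ ma ≡ 1 (mod p)} = ω_m(p)`
(`= 1` if `p ∣ m`, `= 2` if `p ∤ m`; `p` prime). [cite: Maynard2016LargeGaps, §6 display (6.6)] -/
theorem card_filter_range_dvd_or_mul_modEq_one {p : ℕ} (hp : p.Prime) (m : ℕ) :
    ((Finset.range p).filter (fun a => p ∣ a ∨ m * a ≡ 1 [MOD p])).card =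
      if p ∣ m then 1 else 2 := by
  classical
  have hne1 : ∀ a, p ∣ m * a → ¬ m * a ≡ 1 [MOD p] := by
    intro a hd h
    have h0 : m * a ≡ 0 [MOD p] := Nat.modEq_zero_iff_dvd.2 hd
    have : p ∣ 1 := Nat.modEq_zero_iff_dvd.1 (h.symm.trans h0)
    exact hp.one_lt.ne' (Nat.dvd_one.1 this)
  have hsplit : (Finset.range p).filter (fun a => p ∣ a ∨ m * a ≡ 1 [MOD p]) =
      (Finset.range p).filter (fun a => p ∣ a) ∪
        (Finset.range p).filter (fun a => m * a ≡ 1 [MOD p]) := by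
    ext a
    simp only [Finset.mem_filter, Finset.mem_union]
    tauto
  have hdisj : Disjoint ((Finset.range p).filter (fun a => p ∣ a))
      ((Finset.range p).filter (fun a => m * a ≡ 1 [MOD p])) :=
    Finset.disjoint_filter.2 fun a _ ha => hne1 a (ha.mul_left m)
  have hA : (Finset.range p).filter (fun a => p ∣ a) = {0} := by
    ext a
    simp only [Finset.mem_filter, Finset.mem_range, Finset.mem_singleton]
    constructor
    · rintro ⟨h1, h⟩
      exact Nat.eq_zero_of_dvd_of_lt h h1
    · rintro rfl
      exact ⟨hp.pos, dvd_zero p⟩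
  rw [hsplit, Finset.card_union_of_disjoint hdisj, hA, Finset.card_singleton]
  split_ifs with hpm
  · have hB : (Finset.range p).filter (fun a => m * a ≡ 1 [MOD p]) = ∅ :=
      Finset.filter_eq_empty_iff.2 fun a _ h => hne1 a (hpm.mul_right a) h
    rw [hB, Finset.card_empty]
  · have hcop' : Nat.gcd p m = 1 := (Nat.Prime.coprime_iff_not_dvd hp).2 hpm
    have hle : ((Finset.range p).filter (fun a => m * a ≡ 1 [MOD p])).card ≤ 1 := by
      refine Finset.card_le_one.2 fun a ha b hb => ?_
      rw [Finset.mem_filter, Finset.mem_range] at ha hb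
      exact Nat.ModEq.eq_of_lt_of_lt
        (Nat.ModEq.cancel_left_of_coprime hcop' (ha.2.trans hb.2.symm)) ha.1 hb.1
    have hne : ((Finset.range p).filter (fun a => m * a ≡ 1 [MOD p])).Nonempty := by
      have hcop : Nat.Coprime m p := ((Nat.Prime.coprime_iff_not_dvd hp).2 hpm).symm
      obtain ⟨w, hwp, hw⟩ := Nat.exists_mul_mod_eq_one_of_coprime hcop hp.one_lt
      refine ⟨w, Finset.mem_filter.2 ⟨Finset.mem_range.2 hwp, ?_⟩⟩
      show m * w % p = 1 % p
      rw [hw, Nat.mod_eq_of_lt hp.one_lt]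
    have := Finset.card_pos.2 hne
    omega

/-- The complementary local count: `#{0 ≤ a < p : p ∤ a ∧ ma ≢ 1} = p − ω_m(p)`. [cite: Maynard2016LargeGaps, §6 display (6.6)] -/
theorem card_filter_range_not_local {p : ℕ} (hp : p.Prime) (m : ℕ) :
    ((Finset.range p).filter (fun a => ¬ (p ∣ a ∨ m * a ≡ 1 [MOD p]))).card =
      p - (if p ∣ m then 1 else 2) := by
  classical
  have h := Finset.card_filter_add_card_filter_not (s := Finset.range p)
    (fun a => p ∣ a ∨ m * a ≡ 1 [MOD p])
  rw [Finset.card_range, card_filter_range_dvd_or_mul_modEq_one hp m] at h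
  omega

/-- **CRT count modulo a primorial.** For `m ≥ 1` and any `W`:
`#{0 ≤ n < W# : (n(mn − 1), W#) = 1} = ∏_{p ≤ W} (p − ω_m(p))`. [cite: Maynard2016LargeGaps, §6 display (6.6) («split the sum into residue classes modulo P_w»)] -/
theorem card_filter_range_primorial_coprime {m : ℕ} (hm : 1 ≤ m) (W : ℕ) :
    (((Finset.range (primorial W)).filter
        (fun n => Nat.Coprime (n * (m * n - 1)) (primorial W))).card : ℝ) =
      ∏ p ∈ (Finset.range (W + 1)).filter Nat.Prime,
        ((p : ℝ) - ((if p ∣ m then 1 else 2 : ℕ) : ℝ)) := by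
  classical
  set S := (Finset.range (W + 1)).filter Nat.Prime with hSdef
  have hS : ∀ p ∈ S, p.Prime := fun p hp => (Finset.mem_filter.1 hp).2
  have hP : primorial W = ∏ p ∈ S, p := rfl
  set g : ℕ → ℕ → ℝ := fun p r => if ¬ (p ∣ r ∨ m * r ≡ 1 [MOD p]) then 1 else 0 with hgdef
  have hg : ∀ p ∈ S, ∀ t, g p (t % p) = g p t := by
    intro p _ t
    have hloc : (p ∣ t % p ∨ m * (t % p) ≡ 1 [MOD p]) ↔ (p ∣ t ∨ m * t ≡ 1 [MOD p]) := by
      have h := (Nat.mod_modEq t p).mul_left m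
      exact or_congr (Nat.dvd_mod_iff (dvd_refl p)) ⟨fun h1 => h.symm.trans h1, fun h1 => h.trans h1⟩
    simp only [hgdef, hloc]
  have key := GPY.sum_range_prod_eq_prod_sum S hS g hg
  have hL : ∀ r, ∏ p ∈ S, g p r =
      if Nat.Coprime (r * (m * r - 1)) (primorial W) then 1 else 0 := by
    intro r
    simp only [hgdef]
    rw [Finset.prod_boole]
    congr 1
    exact propext (hP ▸ (coprime_mul_sub_one_iff_forall hm S hS)).symm
  have hR : ∀ p ∈ S, ∑ x ∈ Finset.range p, g p x = ((p : ℝ) - ((if p ∣ m then 1 else 2 : ℕ) : ℝ)) := by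
    intro p hp
    simp only [hgdef]
    rw [Finset.sum_boole, card_filter_range_not_local (hS p hp) m]
    have hle : (if p ∣ m then 1 else 2) ≤ p := by
      split_ifs
      · exact (hS p hp).one_lt.le
      · exact (hS p hp).two_le
    rw [Nat.cast_sub hle]
  simp_rw [hL] at key
  rw [Finset.sum_boole, Finset.prod_congr rfl hR, ← hP] at key
  exact key

/-- **The admissible classes modulo `P_w`** (`m ≥ 1`):
`#{0 ≤ n < P_w : (n(mn − 1), P_w) = 1} = ∏_{p ≤ ⌊w⌋} (p − ω_m(p))`. [cite: Maynard2016LargeGaps, §6 display (6.6) («split the sum into residue classes modulo P_w»)] -/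
theorem card_filter_range_Pw_coprime {m : ℕ} (hm : 1 ≤ m) (x : ℕ) :
    (((Finset.range (Pw x)).filter
        (fun n => Nat.Coprime (n * (m * n - 1)) (Pw x))).card : ℝ) =
      ∏ p ∈ (Finset.range (⌊wFun x⌋₊ + 1)).filter Nat.Prime,
        ((p : ℝ) - ((if p ∣ m then 1 else 2 : ℕ) : ℝ)) := by
  unfold Pw
  exact card_filter_range_primorial_coprime hm _

end Maynard2016

end Literature.NumberTheory.Sieve
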